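import Mathlib
import Summits.AtomisticToContinuum.Crystallization.Theses.BraggSlacknessRigidity
import Literature.MathematicalPhysics.StatisticalMechanics.CrystallizationLocalLimit
import Literature.MathematicalPhysics.StatisticalMechanics.LocalMatchingCompactness
import Summits.AtomisticToContinuum.Crystallization.Theorems.BraggSlacknessRigidityHcpDiffractionRigidityDenseCentres
import Summits.AtomisticToContinuum.Crystallization.Theorems.BraggSlacknessRigidityHcpDiffractionRigidityQuietCentres
import Summits.AtomisticToContinuum.Crystallization.Theorems.BraggSlacknessRigidityHcpDiffractionRigidityAdmissibleApprox
import Summits.AtomisticToContinuum.Crystallization.Theorems.BraggSlacknessRigidityHcpDiffractionRigidityDiagonalCentres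
import Summits.AtomisticToContinuum.Crystallization.Theorems.BraggSlacknessRigidityHcpDiffractionRigidityWindowsReturn
import Summits.AtomisticToContinuum.Crystallization.Theorems.BraggSlacknessRigidityHcpDiffractionRigidityLocalLimitTransfer
import Summits.AtomisticToContinuum.Crystallization.Theorems.BraggSlacknessRigidityHcpDiffractionRigidityWindowsOfEssentialPeriodicity
import Summits.AtomisticToContinuum.Crystallization.Theorems.BraggSlacknessRigidityHcpDiffractionRigidityEssentialPeriodicityIrratArith
import Summits.AtomisticToContinuum.Crystallization.Theorems.BraggSlacknessRigidityHcpDiffractionRigidityEssentialPeriodicityOfArith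
import Summits.AtomisticToContinuum.Crystallization.Theorems.BraggSlacknessRigidityCommensurateHcpRigidity
import Summits.AtomisticToContinuum.Crystallization.Theorems.BraggSlacknessRigidityHcpDiffractionRigidityTemplateLatticeSplit
import Summits.AtomisticToContinuum.Crystallization.Theorems.BraggSlacknessRigidityHcpDiffractionRigidityEssentialPeriodLatticeTransc
import Summits.AtomisticToContinuum.Crystallization.Theorems.BraggSlacknessRigidityHcpDiffractionRigidityDualArithTransc

/-!
# hcp-template diffraction rigidity for commensurate or transcendental templates
# (toward crux `HcpDiffractionRigidity`, item `stmt-AtomisticToContinuum-13166`)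

The crux `HcpDiffractionRigidity` restricted to templates `P = hcpPeriodicConfiguration a h` with
`h² = q a²` (`q ∈ ℚ`) OR `h²/a²` transcendental over `ℚ`: hard core + asymptotically exact pair
distances (S2) + a structure factor quiet off the Bragg spheres (S3) force a crystalline local
limit along a re-centred subsequence.  Commensurate branch: `CommensurateHcpRigidity` (closed item
`stmt-AtomisticToContinuum-13168`).  Transcendental branch: the essential period lattice
(`stub_essentialPeriodLatticeTransc`), the template-lattice split (`stub_templateLatticeSplit`), the
periods `V = (D/a²)M₂ + (D/h²)ℤv`, the split arithmetic lemma
(`stub_essentialPeriodicityIrratArith`), the generic essential-periodicity theorem with `k = 24D`,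
periodic windows, return of the windows, and the Literature matching lemma.  The remaining case of
the crux — `h²/a²` algebraic irrational — is exactly the open research kernel
`stub_essentialPeriodLattice` of the line `registered`.

All `[folklore]` as assembly; the mathematics is in the imported files.
-/

noncomputable section

namespace Summit.AtomisticToContinuum.Crystallization.Theorems

namespace TranscendentalHcpRigidityProof

open Literature.MathematicalPhysics.StatisticalMechanics
open scoped BigOperators Classical RealInnerProductSpace
open Filter

/-- **Layered confinement, transcendental template.** The essential period lattice (transcendental
case) consists of template-length vectors, hence is split up to its index, and `Λ` lies in the split
lattice. [folklore] -/
theorem layeredConfinement_transc (a h : ℝ) (ha : a ≠ 0) (hh : h ≠ 0)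
    (ht : Transcendental ℚ (h ^ 2 / a ^ 2)) (δ : ℝ) (hδ : 0 < δ) (Λ : Set (EuclideanSpace ℝ (Fin 3)))
    (hsep : ∀ p ∈ Λ, ∀ q ∈ Λ, p ≠ q → δ ≤ dist p q) (h0 : (0 : EuclideanSpace ℝ (Fin 3)) ∈ Λ)
    (hE : ∀ p ∈ Λ, ∀ q ∈ Λ, ∃ a' ∈ (hcpPeriodicConfiguration ha hh).points,
      ∃ b' ∈ (hcpPeriodicConfiguration ha hh).points, dist p q = dist a' b')
    (hQ : ∃ L : ℕ → ℝ, Filter.Tendsto L Filter.atTop Filter.atTop ∧ ∀ g : EuclideanSpace ℝ (Fin 3) → ℝ, Continuous g →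
      HasCompactSupport g → (∀ ξ ∈ tsupport g, ξ ≠ 0 ∧ ∀ k : EuclideanSpace ℝ (Fin 3),
        (∀ v ∈ (hcpPeriodicConfiguration ha hh).lattice, ∃ n : ℤ, inner ℝ k v = (n : ℝ)) → ‖ξ‖ ≠ ‖k‖) →
      ∀ ε : ℝ, 0 < ε → ∀ᶠ t : ℕ in Filter.atTop, (∫ ξ, g ξ * ‖∑' s : Λ,
        (Real.exp (-(‖(s : EuclideanSpace ℝ (Fin 3))‖ ^ 2) / L t ^ 2) : ℂ) *
          Complex.exp (2 * Real.pi * Complex.I * (inner ℝ ξ (s : EuclideanSpace ℝ (Fin 3)) : ℂ))‖ ^ 2) ≤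
        ε * ∑' s : Λ, Real.exp (-(‖(s : EuclideanSpace ℝ (Fin 3))‖ ^ 2) / L t ^ 2) ^ 2) :
    ∃ (M₂ : Submodule ℤ (EuclideanSpace ℝ (Fin 3))) (v : EuclideanSpace ℝ (Fin 3)) (D : ℕ), 0 < D ∧ v ≠ 0 ∧ (∀ u ∈ M₂, inner ℝ u v = 0) ∧
      (∀ u ∈ M₂, ∀ w ∈ M₂, ∃ n : ℤ, (D : ℝ) * inner ℝ u w = (n : ℝ) * a ^ 2) ∧
      (∃ n : ℤ, (D : ℝ) * ‖v‖ ^ 2 = (n : ℝ) * h ^ 2) ∧ DiscreteTopology ↥(M₂ ⊔ Submodule.span ℤ {v}) ∧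
      Submodule.span ℝ ((M₂ ⊔ Submodule.span ℤ {v} : Submodule ℤ (EuclideanSpace ℝ (Fin 3))) : Set (EuclideanSpace ℝ (Fin 3))) = ⊤ ∧
      Λ ⊆ ↑(M₂ ⊔ Submodule.span ℤ {v}) := by
  obtain ⟨N, k, hNd, hNspan, hk, hNdiff, hkΛ⟩ :=
    stub_essentialPeriodLatticeTransc a h ha hh ht δ hδ Λ hsep h0 hE hQ
  have hNlen : ∀ z ∈ N, ∃ a' ∈ (hcpPeriodicConfiguration ha hh).points,
      ∃ b' ∈ (hcpPeriodicConfiguration ha hh).points, ‖z‖ = dist a' b' := by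
    intro z hz
    obtain ⟨p, hp, q, hq', rfl⟩ := hNdiff z hz
    obtain ⟨a', ha', b', hb', hd⟩ := hE p hp q hq'
    exact ⟨a', ha', b', hb', by rw [← dist_eq_norm, hd]⟩
  obtain ⟨M₂, v, D, hD, hv, hperp, hgram, hvv, hdisc, hspan, hmem⟩ :=
    stub_templateLatticeSplit a h ha hh (HcpRigidityDualArith.not_exists_rat_of_transcendental ha ht) N hNd hNspan
      hNlen k hk
  exact ⟨M₂, v, D, hD, hv, hperp, hgram, hvv, hdisc, hspan, fun p hp => hmem p (hkΛ p hp)⟩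

/-- **Rigidity of one quiet exact limit set, transcendental template** (layered confinement, the
periods `V = (D/a²)M₂ + (D/h²)ℤv`, the split arithmetic lemma, the generic essential-periodicity
theorem with `k = 24D`, periodic windows). [folklore] -/
theorem limitRigidity_transc (a h : ℝ) (ha : a ≠ 0) (hh : h ≠ 0)
    (ht : Transcendental ℚ (h ^ 2 / a ^ 2)) (δ : ℝ) (hδ : 0 < δ) (Λ : Set (EuclideanSpace ℝ (Fin 3)))
    (hsep : ∀ p ∈ Λ, ∀ q ∈ Λ, p ≠ q → δ ≤ dist p q) (h0 : (0 : EuclideanSpace ℝ (Fin 3)) ∈ Λ)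
    (hE : ∀ p ∈ Λ, ∀ q ∈ Λ, ∃ a' ∈ (hcpPeriodicConfiguration ha hh).points,
      ∃ b' ∈ (hcpPeriodicConfiguration ha hh).points, dist p q = dist a' b')
    (hQ : ∃ L : ℕ → ℝ, Filter.Tendsto L Filter.atTop Filter.atTop ∧ ∀ g : EuclideanSpace ℝ (Fin 3) → ℝ, Continuous g →
      HasCompactSupport g → (∀ ξ ∈ tsupport g, ξ ≠ 0 ∧ ∀ k : EuclideanSpace ℝ (Fin 3),
        (∀ v ∈ (hcpPeriodicConfiguration ha hh).lattice, ∃ n : ℤ, inner ℝ k v = (n : ℝ)) → ‖ξ‖ ≠ ‖k‖) →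
      ∀ ε : ℝ, 0 < ε → ∀ᶠ t : ℕ in Filter.atTop, (∫ ξ, g ξ * ‖∑' s : Λ,
        (Real.exp (-(‖(s : EuclideanSpace ℝ (Fin 3))‖ ^ 2) / L t ^ 2) : ℂ) *
          Complex.exp (2 * Real.pi * Complex.I * (inner ℝ ξ (s : EuclideanSpace ℝ (Fin 3)) : ℂ))‖ ^ 2) ≤
        ε * ∑' s : Λ, Real.exp (-(‖(s : EuclideanSpace ℝ (Fin 3))‖ ^ 2) / L t ^ 2) ^ 2) :
    ∃ Q : Literature.MathematicalPhysics.StatisticalMechanics.PeriodicConfiguration 3, ∀ R ε : ℝ, 0 < ε → ∃ c : EuclideanSpace ℝ (Fin 3),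
      (∀ s ∈ Q.points, ‖s‖ ≤ R → ∃ p ∈ Λ, dist (p - c) s ≤ ε) ∧
      (∀ p ∈ Λ, ‖p - c‖ ≤ R → ∃ s ∈ Q.points, dist (p - c) s ≤ ε) := by
  have hq := HcpRigidityDualArith.not_exists_rat_of_transcendental ha ht
  obtain ⟨M₂, v, D, hD, hv, hperp, hgram, hvv, hdisc, hspan, hΛM⟩ :=
    layeredConfinement_transc a h ha hh ht δ hδ Λ hsep h0 hE hQ
  obtain ⟨L, hL, hquiet⟩ := hQ
  haveI := hdisc
  set M : Submodule ℤ (EuclideanSpace ℝ (Fin 3)) := M₂ ⊔ Submodule.span ℤ {v} with hMdef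
  -- the periods of `|S_t|²`
  set V : Set (EuclideanSpace ℝ (Fin 3)) := {m | ∃ b ∈ M₂, ∃ j : ℤ,
    m = ((D : ℝ) / a ^ 2) • b + ((D : ℝ) * (j : ℝ) / h ^ 2) • v} with hVdef
  obtain ⟨nv, hnv⟩ := hvv
  have ha2 : a ^ 2 ≠ 0 := pow_ne_zero 2 ha
  have hh2 : h ^ 2 ≠ 0 := pow_ne_zero 2 hh
  have hV : ∀ m ∈ V, ∀ s ∈ Λ, ∃ n : ℤ, inner ℝ m s = (n : ℝ) := by
    rintro m ⟨b, hb, j, rfl⟩ s hs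
    obtain ⟨s₂, hs₂, w, hw, hsw⟩ := Submodule.mem_sup.1 (hΛM hs)
    obtain ⟨j', rfl⟩ := Submodule.mem_span_singleton.1 hw
    have hs' : s = s₂ + (j' : ℝ) • v := by rw [Int.cast_smul_eq_zsmul]; exact hsw.symm
    obtain ⟨n₁, hn₁⟩ := hgram b hb s₂ hs₂
    refine ⟨n₁ + j * j' * nv, ?_⟩
    have h1 : inner ℝ b v = 0 := hperp b hb
    have h2 : inner ℝ v s₂ = 0 := by rw [real_inner_comm]; exact hperp s₂ hs₂
    have h3 : inner ℝ v v = ‖v‖ ^ 2 := real_inner_self_eq_norm_sq v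
    rw [hs']
    simp only [inner_add_left, inner_add_right, real_inner_smul_left, real_inner_smul_right, h1, h2,
      h3, mul_zero, add_zero, zero_add]
    push_cast
    field_simp
    linear_combination h ^ 2 * hn₁ + (j : ℝ) * (j' : ℝ) * a ^ 2 * hnv
  -- the arithmetic input with `k = 24 D`
  have hk : 0 < 24 * D := by positivity
  have harith : ∀ ξ : EuclideanSpace ℝ (Fin 3), (∀ m ∈ V, ¬ (ξ + m ≠ 0 ∧ ∀ k' : EuclideanSpace ℝ (Fin 3),
      (∀ v ∈ (hcpPeriodicConfiguration ha hh).lattice,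
        ∃ n : ℤ, inner ℝ k' v = (n : ℝ)) → ‖ξ + m‖ ≠ ‖k'‖)) →
      ∀ z ∈ M, ∃ n : ℤ, ((24 * D : ℕ) : ℝ) * inner ℝ ξ z = (n : ℝ) := by
    intro ξ hξ z hz
    obtain ⟨z₂, hz₂, w, hw, rfl⟩ := Submodule.mem_sup.1 hz
    obtain ⟨j, rfl⟩ := Submodule.mem_span_singleton.1 hw
    rw [← Int.cast_smul_eq_zsmul ℝ j v]
    refine stub_essentialPeriodicityIrratArith a h ha hh hq M₂ v D hD hperp hgram ⟨nv, hnv⟩ ξ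
      (fun b hb j' => ?_) z₂ hz₂ j
    have := hξ (((D : ℝ) / a ^ 2) • b + ((D : ℝ) * (j' : ℝ) / h ^ 2) • v) ⟨b, hb, j', rfl⟩
    rwa [← add_assoc] at this
  obtain ⟨M', k', hk', hM'M, hkM, hess⟩ :=
    stub_essentialPeriodicityOfArith _ δ hδ Λ hsep M hdisc hΛM L hL hquiet V hV (24 * D) hk harith
  exact stub_windowsOfEssentialPeriodicity δ hδ Λ hsep h0 M hdisc hspan hΛM M' k' hk' hM'M hkM
    ⟨L, hL, hess⟩

/-- **Rigidity of quiet exact windows, transcendental template (Goal B)** (B1 +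
`limitRigidity_transc` + B3). [folklore] -/
theorem quietExactWindowsRigidity_transc (a h : ℝ) (ha : a ≠ 0) (hh : h ≠ 0)
    (ht : Transcendental ℚ (h ^ 2 / a ^ 2)) (δ : ℝ) (hδ : 0 < δ) (n : ℕ → ℕ)
    (y : (j : ℕ) → (Fin (n j) → EuclideanSpace ℝ (Fin 3)))
    (hsep : ∀ (j : ℕ) (i i' : Fin (n j)), i ≠ i' → δ ≤ dist (y j i) (y j i'))
    (h0 : ∀ j : ℕ, ∃ i : Fin (n j), y j i = 0)
    (hE : ∀ R η : ℝ, 0 < η → ∀ᶠ j : ℕ in Filter.atTop, ∀ i i' : Fin (n j), i ≠ i' → ‖y j i‖ ≤ R →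
      ‖y j i'‖ ≤ R → ∃ a' ∈ (hcpPeriodicConfiguration ha hh).points,
        ∃ b' ∈ (hcpPeriodicConfiguration ha hh).points, |dist (y j i) (y j i') - dist a' b'| < η)
    (hQ : ∃ L : ℕ → ℝ, Filter.Tendsto L Filter.atTop Filter.atTop ∧ ∀ g : EuclideanSpace ℝ (Fin 3) → ℝ, Continuous g →
      HasCompactSupport g → (∀ ξ ∈ tsupport g, ξ ≠ 0 ∧ ∀ k : EuclideanSpace ℝ (Fin 3),
        (∀ v ∈ (hcpPeriodicConfiguration ha hh).lattice, ∃ n : ℤ, inner ℝ k v = (n : ℝ)) → ‖ξ‖ ≠ ‖k‖) →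
      ∀ ε : ℝ, 0 < ε → ∀ᶠ t : ℕ in Filter.atTop, ∀ᶠ j : ℕ in Filter.atTop,
        (∫ ξ, g ξ * ‖∑ i : Fin (n j), (Real.exp (-(‖y j i‖ ^ 2) / L t ^ 2) : ℂ) *
          Complex.exp (2 * Real.pi * Complex.I * (inner ℝ ξ (y j i) : ℂ))‖ ^ 2) ≤
        ε * ∑ i : Fin (n j), Real.exp (-(‖y j i‖ ^ 2) / L t ^ 2) ^ 2) :
    ∃ (ψ : ℕ → ℕ) (σ : ℕ → EuclideanSpace ℝ (Fin 3)) (Q : Literature.MathematicalPhysics.StatisticalMechanics.PeriodicConfiguration 3), StrictMono ψ ∧ ∀ R ε : ℝ, 0 < ε →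
      ∀ᶠ k : ℕ in Filter.atTop, (∀ s ∈ Q.points, ‖s‖ ≤ R → ∃ i : Fin (n (ψ k)), dist (y (ψ k) i + σ k) s ≤ ε) ∧
        (∀ i : Fin (n (ψ k)), ‖y (ψ k) i + σ k‖ ≤ R → ∃ s ∈ Q.points, dist (y (ψ k) i + σ k) s ≤ ε) := by
  obtain ⟨ψ, Λ, hψ, hΛsep, hΛ0, hΛE, hΛQ, hconv⟩ :=
    stub_localLimitTransfer (hcpPeriodicConfiguration ha hh) δ hδ n y hsep h0 hE hQ
  obtain ⟨Q, hwin⟩ := limitRigidity_transc a h ha hh ht δ hδ Λ hΛsep hΛ0 hΛE hΛQ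
  obtain ⟨κ, σ, hκ, hmatch⟩ :=
    stub_windowsReturn (fun k => n (ψ k)) (fun k => y (ψ k)) Λ Q hconv hwin
  exact ⟨fun k => ψ (κ k), σ, Q, hψ.comp hκ, hmatch⟩

end TranscendentalHcpRigidityProof

open TranscendentalHcpRigidityProof CommensurateHcpRigidityProof
  Literature.MathematicalPhysics.StatisticalMechanics Filter in
open scoped Classical in
/-- **hcp-template diffraction rigidity for commensurate or transcendental templates.** The crux
`HcpDiffractionRigidity` restricted to templates `hcpPeriodicConfiguration a h` with `h² = q a²`,
`q ∈ ℚ`, OR `h²/a²` transcendental: hard core + asymptotically exact pair distances (S2) + a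
structure factor quiet off the Bragg spheres (S3) force a crystalline local limit along a re-centred
subsequence.  (The remaining case of the crux — `h²/a²` algebraic irrational — is the open research
kernel `stub_essentialPeriodLattice`.) [folklore] -/
theorem hcpDiffractionRigidity_of_commensurate_or_transcendental :
    ∀ (P : Literature.MathematicalPhysics.StatisticalMechanics.PeriodicConfiguration 3), (∃ (a h : ℝ) (ha : a ≠ 0) (hh : h ≠ 0),
      P = hcpPeriodicConfiguration ha hh ∧ ((∃ q : ℚ, h ^ 2 = (q : ℝ) * a ^ 2) ∨
        Transcendental ℚ (h ^ 2 / a ^ 2))) → ∀ δ : ℝ, 0 < δ → ∀ x : (N : ℕ) → (Fin N → EuclideanSpace ℝ (Fin 3)),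
      (∀ (N : ℕ) (i j : Fin N), i ≠ j → δ ≤ dist (x N i) (x N j)) →
      (∀ R η : ℝ, 0 < η → Filter.Tendsto (fun N : ℕ => (Nat.card {p : Fin N × Fin N // p.1 ≠ p.2 ∧
        dist (x N p.1) (x N p.2) ≤ R ∧ ∀ a ∈ P.points, ∀ b ∈ P.points,
          η ≤ |dist (x N p.1) (x N p.2) - dist a b|} : ℝ) / N) Filter.atTop (nhds 0)) →
      (∀ h : EuclideanSpace ℝ (Fin 3) → ℝ, Continuous h → HasCompactSupport h → (∀ ξ ∈ tsupport h, ξ ≠ 0 ∧ ∀ k : EuclideanSpace ℝ (Fin 3),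
        (∀ g ∈ P.lattice, ∃ n : ℤ, inner ℝ k g = (n : ℝ)) → ‖ξ‖ ≠ ‖k‖) →
        Filter.Tendsto (fun N : ℕ => (∫ ξ, h ξ * ‖∑ j : Fin N,
          Complex.exp (2 * Real.pi * Complex.I * (inner ℝ ξ (x N j) : ℂ))‖ ^ 2) / N) Filter.atTop (nhds 0)) →
      ∃ (φ : ℕ → ℕ) (τ : ℕ → EuclideanSpace ℝ (Fin 3)) (Q : Literature.MathematicalPhysics.StatisticalMechanics.PeriodicConfiguration 3) (m : EuclideanSpace ℝ (Fin 3) → ℕ), StrictMono φ ∧ (∀ s ∈ Q.points, 1 ≤ m s) ∧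
        (∀ g ∈ Q.lattice, ∀ s, m (s + g) = m s) ∧ ∀ f : EuclideanSpace ℝ (Fin 3) → ℝ, Continuous f → HasCompactSupport f →
          Filter.Tendsto (fun j => ∑ i : Fin (φ j), f (x (φ j) i + τ j)) Filter.atTop
            (nhds (∑' s : Q.points, (m s : ℝ) * f s)) := by
  intro P hP δ hδ x hsep hS2 hS3
  obtain ⟨a, h, ha, hh, rfl, hcase⟩ := hP
  -- Goal A: typical centres
  obtain ⟨φ, τ, hφ, h0, hex, hquiet⟩ := stub_diagonalCentres (hcpPeriodicConfiguration ha hh) δ hδ x hsep hS2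
    (stub_denseCentres _ δ hδ x hsep hS3) (stub_quietCentres _ δ hδ x hsep hS3)
    (stub_admissibleApprox _ δ hδ)
  have hsep' : ∀ (j : ℕ) (i i' : Fin (φ j)), i ≠ i' →
      δ ≤ dist (x (φ j) i + τ j) (x (φ j) i' + τ j) := fun j i i' hne => by
    rw [dist_add_right]
    exact hsep (φ j) i i' hne
  -- Goal B on the re-centred subsequence, in the two cases
  obtain ⟨ψ, σ, Q, hψ, hmatch⟩ : ∃ (ψ : ℕ → ℕ) (σ : ℕ → EuclideanSpace ℝ (Fin 3)) (Q : Literature.MathematicalPhysics.StatisticalMechanics.PeriodicConfiguration 3), StrictMono ψ ∧ ∀ R ε : ℝ, 0 < ε →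
      ∀ᶠ k : ℕ in Filter.atTop, (∀ s ∈ Q.points, ‖s‖ ≤ R → ∃ i : Fin (φ (ψ k)),
        dist (x (φ (ψ k)) i + τ (ψ k) + σ k) s ≤ ε) ∧
        (∀ i : Fin (φ (ψ k)), ‖x (φ (ψ k)) i + τ (ψ k) + σ k‖ ≤ R → ∃ s ∈ Q.points,
          dist (x (φ (ψ k)) i + τ (ψ k) + σ k) s ≤ ε) := by
    rcases hcase with hq | ht
    · exact quietExactWindowsRigidity_commensurate a h ha hh hq δ hδ φ
        (fun j i => x (φ j) i + τ j) hsep' h0 hex hquiet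
    · exact quietExactWindowsRigidity_transc a h ha hh ht δ hδ φ
        (fun j i => x (φ j) i + τ j) hsep' h0 hex hquiet
  refine ⟨fun k => φ (ψ k), fun k => τ (ψ k) + σ k, Q, fun _ => 1, hφ.comp hψ,
    fun s _ => le_rfl, fun g _ s => rfl, fun f hfc hf => ?_⟩
  have hsep'' : ∀ (k : ℕ) (i i' : Fin (φ (ψ k))), i ≠ i' →
      δ ≤ dist (x (φ (ψ k)) i + τ (ψ k) + σ k) (x (φ (ψ k)) i' + τ (ψ k) + σ k) :=
    fun k i i' hne => by
    rw [dist_add_right]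
    exact hsep' (ψ k) i i' hne
  have key := Q.tendsto_sum_of_eventually_near' (n := fun k => φ (ψ k))
    (fun k i => x (φ (ψ k)) i + τ (ψ k) + σ k) hδ hsep'' hmatch hfc hf
  simpa only [add_assoc] using key

end Summit.AtomisticToContinuum.Crystallization.Theorems

end
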